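import Summits.QuantumFields.BalabanUV.T4Continuum.Support.ShellMeasureLandauHolonomyChart

/-!
# `T4Continuum.ShellMeasureLiveEndLevelBlind` — owner audit γ11 of THE ONE CALL (row S92): the classifier read-out
# constants `κr`, `κc` of `ShellMeasureLiveEndOneCall.shellWeightBound_live_oneCall` are LEVEL-BLIND; across the live
# levels of all comparisons they are jointly inhabitable with the Stokes-currency rows `ha`∕`hs₁` ONLY by vanishing
# read-outs (FINDING F-ne7cp1-g34-1), and the level-indexed repair is inhabited from three level-free numbers
(cell `pub-balaban`, sub-cell `t4`, spine estimate NE7c (node U5b); lineage `b2b-balaban-t4-ne7c-p1` = PROVER seat P1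
«shell-measure route», generation 34, `HOME/BINDER-OWNERS.md` row NE7c OWNER; ADDITIVE — imports
`ShellMeasureLandauHolonomyChart` only; 0 `def`, 0 `def … : Prop`, 0 sorry, 0 citation tags)

HONEST FRAMING.  Finite four-torus programme, rung (B)+1 only — NOT infinite volume, NOT a mass gap, NOT the Clay
problem, NOT summit progress; (B), `BetaPertHyp`, (B^μ) not consumed.  NE7c (`T4IndicatorShell.ShellWeightBound`) is NOT
PRINTED in [Balaban 1983–89] and NOT PROVED; «NE7c ⇐ the named binders».  This file is an audit of OUR wiring (like
`ShellMeasureWilsonSquare.letterwise_hSM_fails`, `ShellMeasureThresholdUnits.fineCurrency_closeness_fails`): nothing of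
Bałaban's is discharged, no located input is added.
HONEST DEPENDENCY (cell, verbatim): continuum YM on T⁴ ⇐ BetaPertH ∧ nine spine estimates (0/9 proved); BetaPertH ⇐
(D1) ∧ (D4) ∧ CAP+tail; G-an2-4 gates asym, D1 and NE2/3/4.  (v1.2, DOCFIX D-ref23-1 of crew referee pass 23: this
sentence was missing from v1∕v1.1; every declaration below is byte-identical to v1.1 p232328.  STATUS after row S95
p232688∕p232915∕p232965: the level-indexed repair of §4–§5 is THE ONE CALL OF RECORD
`ShellMeasureLiveEndOneCallUnionLevels.shellWeightBound_live_oneCall_union_levels`; this file remains the audit record.)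

THE POINT.  S80 f3 `ShellMeasureLandauEndRayStokesAssembledDecay.slotAC_realized_su2_landauChart_assembled_decay` is a
ONE-SLOT theorem: its classifier read-out bound `κr` ((19) n = 0 TYPE), curl read-out bound `κc` ((19) n = 1, (25) TYPE)
and fine scale `η` are that slot's numbers, tied by the Stokes-currency rows (F-ne7cp1-g31-1)
`ha : κr·X ≤ c₂·η·z`, `hs₁ : κc·X ≤ c₁·η²·z` (`X` = the Landau exponent's amplitude, level-free, `X > 0` forced by the
chart row `hΦ : ‖Φ z‖ < 2dLC₁ε₁` and `0 < B₀`) — i.e. `κr ∝ η_j`, `κc ∝ η_j²` AT THE SLOT'S LEVEL `j`.  The family lift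
S92 f1∕f2 (`hac_live_of_assembled_decay`, `shellWeightBound_live_oneCall`) indexes `η` by the slot's lattice level
`η r (jl r K s)` but keeps `κr κc : ℝ` SINGLE for every run `r`, comparison `K` and slot `s`, with
`ha : ∀ r K s, κr·X ≤ c₂·η r (jl r K s)·zs`.  §1–§2: if the fine scales of the slots have infimum `0` — the designed
profile `η r j = L^{−j}` (γ8, `ShellMeasureThresholdUnits`) over the live levels `K − N₁ ≤ j ≤ K` of ALL comparisons
`K` — then `κr = κc = 0`; §3: then every classifier read-out is the zero map, every DEFINED holonomy `holOf (ℓs p) Z ≡ 1`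
and the DEFINED classifier `≡ 0`, so by the dictionary row `hudict` the tested variable vanishes on every chart section:
the ONE CALL's binder family is inhabited across the levels only by a DEGENERATE slot (rule G-1's concern, with «two
levels of different fine scale» as the nonempty index set; the one-level toy S88 = test (x1) cannot see it).  §4: the
REPAIR is the level-indexed lift `κr r j := κ̄r·η r j`, `κc r j := κ̄c·(η r j)²` — S80 f3's three rows hold AT EVERY
LEVEL from the level-free numbers `κ̄c·X ≤ c₁·zs`, `κ̄r·X ≤ c₂·zs`, `m·κ̄r·X ≤ 1` and `η ≤ 1` (files 1–2 v2: type
`κr κc` as `Bool → ℕ → ℝ` read at `jl r K s`, `hma` per slot; the call site already passes per-slot instances).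
§5 (v1.1): the second level-blind number — the depth-weighted plaquette count `Kw` of the Wilson leg caps the number of
depth-zero plaquettes of every slot of every level by ONE real, while the designed count is `c_geo·L^{4j}`.
Not a kernel error anywhere: S92 is correct as stated; the finding is about JOINT INHABITABILITY BY THE DESIGNED OBJECTS.
-/

noncomputable section

open Set Metric NormedSpace Finset

namespace Summit.QuantumFields.BalabanUV.T4Continuum.ShellMeasureLiveEndLevelBlind

open ShellMeasureWilsonWords (wordExp wordExp_nil wordExp_cons)
open ShellMeasureLevelAssembly (classifier)
open ShellMeasureLandauHolonomyChart (holOf holOf_apply)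

/-! ## §1 The obstruction: a constant dominated by `c·f(i)·z` along a family with `inf |f| = 0` vanishes -/

/-- **LEVEL-BLIND CONSTANT LEMMA.**  If `0 ≤ κ`, `0 < X` and `κ·X ≤ c·f i·z` for every index `i` of a family whose
values come arbitrarily close to `0`, then `κ = 0`. [folklore] -/
theorem const_eq_zero_of_forall_le {ι : Sort*} {κ X c z : ℝ} {f : ι → ℝ} (hκ : 0 ≤ κ) (hX : 0 < X)
    (ha : ∀ i, κ * X ≤ c * f i * z) (hinf : ∀ d : ℝ, 0 < d → ∃ i, |f i| < d) : κ = 0 := by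
  by_contra hne
  have hκ' : 0 < κ := lt_of_le_of_ne hκ (Ne.symm hne)
  have hκX : 0 < κ * X := mul_pos hκ' hX
  set d : ℝ := κ * X / (|c| * |z| + 1) with hd
  have hden : 0 < |c| * |z| + 1 := by positivity
  have hd0 : 0 < d := div_pos hκX hden
  obtain ⟨i, hi⟩ := hinf d hd0
  have h1 : κ * X ≤ |c| * |f i| * |z| := by
    calc κ * X ≤ c * f i * z := ha i
      _ ≤ |c * f i * z| := le_abs_self _
      _ = |c| * |f i| * |z| := by rw [abs_mul, abs_mul]
  have h2 : |c| * |f i| * |z| ≤ |c| * |z| * d := by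
    have : |c| * |f i| * |z| = (|c| * |z|) * |f i| := by ring
    rw [this]
    exact mul_le_mul_of_nonneg_left hi.le (by positivity)
  have h3 : |c| * |z| * d < κ * X := by
    rw [hd, ← mul_div_assoc, div_lt_iff₀ hden]
    nlinarith [abs_nonneg c, abs_nonneg z]
  linarith

/-- The squared family inherits `inf = 0`. [folklore] -/
theorem inf_sq_of_inf {ι : Sort*} {f : ι → ℝ} (hinf : ∀ d : ℝ, 0 < d → ∃ i, |f i| < d) :
    ∀ d : ℝ, 0 < d → ∃ i, |f i ^ 2| < d := by
  intro d hd
  obtain ⟨i, hi⟩ := hinf (min d 1) (lt_min hd one_pos)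
  refine ⟨i, ?_⟩
  have h0 : 0 ≤ |f i| := abs_nonneg _
  have hlt1 : |f i| < 1 := lt_of_lt_of_le hi (min_le_right _ _)
  have hltd : |f i| < d := lt_of_lt_of_le hi (min_le_left _ _)
  rw [abs_pow, sq]
  calc |f i| * |f i| ≤ |f i| * 1 := mul_le_mul_of_nonneg_left hlt1.le h0
    _ = |f i| := mul_one _
    _ < d := hltd

/-- **THE ONE CALL'S ROWS `ha`, `hs₁` WITH LEVEL-BLIND `κr`, `κc` (S92 f2's spelling: run `r : Bool`, comparison `K`,
slot `s`, fine scale `η r (jl r K s)`).**  If the slots' fine scales have infimum `0`, both read-out constants vanish.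
[folklore] -/
theorem levelBlind_readOuts_eq_zero {σ : Type*} {κr κc X c₁ c₂ zs : ℝ} {η : Bool → ℕ → ℝ} {jl : Bool → ℕ → σ → ℕ}
    (hκ : 0 ≤ κr) (hκc : 0 ≤ κc) (hX : 0 < X)
    (hs₁ : ∀ r K s, κc * X ≤ c₁ * η r (jl r K s) ^ 2 * zs) (ha : ∀ r K s, κr * X ≤ c₂ * η r (jl r K s) * zs)
    (hinf : ∀ d : ℝ, 0 < d → ∃ r K s, |η r (jl r K s)| < d) : κr = 0 ∧ κc = 0 := by
  have hinf' : ∀ d : ℝ, 0 < d → ∃ i : Bool × ℕ × σ, |η i.1 (jl i.1 i.2.1 i.2.2)| < d := fun d hd => by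
    obtain ⟨r, K, s, h⟩ := hinf d hd; exact ⟨(r, K, s), h⟩
  refine ⟨const_eq_zero_of_forall_le (f := fun i : Bool × ℕ × σ => η i.1 (jl i.1 i.2.1 i.2.2)) hκ hX
      (fun i => ha i.1 i.2.1 i.2.2) hinf', ?_⟩
  exact const_eq_zero_of_forall_le (f := fun i : Bool × ℕ × σ => η i.1 (jl i.1 i.2.1 i.2.2) ^ 2) hκc hX
    (fun i => hs₁ i.1 i.2.1 i.2.2) (inf_sq_of_inf hinf')

/-! ## §2 The two side conditions are the ONE CALL's own rows ∕ the designed scale profile -/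

/-- `X > 0` IS FORCED: the chart row `hΦ : ∀ z ∈ ball 0 r_Φ, ‖Φ z‖ < b` at `z = 0` gives `0 < b`. [folklore] -/
theorem bound_pos_of_strict_ball_bound {E F : Type*} [SeminormedAddCommGroup E] [SeminormedAddCommGroup F]
    {Φ : E → F} {rΦ b : ℝ} (hr : 0 < rΦ) (hΦ : ∀ z ∈ ball (0 : E) rΦ, ‖Φ z‖ < b) : 0 < b :=
  lt_of_le_of_lt (norm_nonneg _) (hΦ 0 (mem_ball_self hr))

/-- … and then the Landau amplitude `X = (ε₄ + B₀·b) + B₀·(4C₂(ε₄ + B₀·b)²)` of S80 f3 ∕ S92 is positive. [folklore] -/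
theorem landauAmplitude_pos {B₀ b ε₄ C₂ : ℝ} (hB₀ : 0 < B₀) (hb : 0 < b) (hε₄ : 0 ≤ ε₄) (hC₂ : 0 ≤ C₂) :
    0 < (ε₄ + B₀ * b) + B₀ * (4 * C₂ * (ε₄ + B₀ * b) ^ 2) := by
  have h1 : 0 < ε₄ + B₀ * b := by positivity
  positivity

/-- THE DESIGNED PROFILE HAS INFIMUM ZERO: `η j = (L^j)⁻¹` with `1 < L` comes below every `d > 0`. [folklore] -/
theorem exists_inv_pow_lt {L : ℝ} (hL : 1 < L) (d : ℝ) (hd : 0 < d) : ∃ j : ℕ, |(L ^ j)⁻¹| < d := by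
  have hL0 : 0 < L := lt_trans one_pos hL
  obtain ⟨j, hj⟩ := exists_pow_lt_of_lt_one hd (inv_lt_one_of_one_lt₀ hL)
  refine ⟨j, ?_⟩
  rw [← inv_pow, abs_of_nonneg (pow_nonneg (inv_nonneg.2 hL0.le) _)]
  exact hj

/-- … so if the slots realise arbitrarily HIGH lattice levels (the live levels `K − N₁ ≤ j ≤ K` over all comparisons
`K` do) and `η r j = (L^j)⁻¹`, the side condition `hinf` of §1 holds. [folklore] -/
theorem hinf_of_designed_profile {σ : Type*} {L : ℝ} (hL : 1 < L) {η : Bool → ℕ → ℝ} {jl : Bool → ℕ → σ → ℕ}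
    (hη : ∀ r j, η r j = (L ^ j)⁻¹) (hlev : ∀ J : ℕ, ∃ r K s, J ≤ jl r K s) :
    ∀ d : ℝ, 0 < d → ∃ r K s, |η r (jl r K s)| < d := by
  intro d hd
  obtain ⟨J, hJ⟩ := exists_inv_pow_lt hL d hd
  obtain ⟨r, K, s, hle⟩ := hlev J
  refine ⟨r, K, s, ?_⟩
  have hL0 : 0 < L := lt_trans one_pos hL
  rw [hη]
  rw [abs_of_nonneg (inv_nonneg.2 (pow_nonneg hL0.le _))] at hJ ⊢
  exact lt_of_le_of_lt (inv_anti₀ (pow_pos hL0 _) (pow_le_pow_right₀ hL.le hle)) hJ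

/-! ## §3 Consequence: zero read-outs ⟹ trivial holonomy ⟹ the DEFINED classifier vanishes identically -/

section Classifier

variable {𝒴 : Type*} [NormedAddCommGroup 𝒴] [NormedSpace ℂ 𝒴]
variable {A : Type*} [NormedRing A] [NormedAlgebra ℂ A]

/-- A read-out with operator bound `0` is the zero map. [folklore] -/
theorem readOut_eq_zero {ℓ : 𝒴 →L[ℂ] A} (h : ∀ Y, ‖ℓ Y‖ ≤ 0 * ‖Y‖) : ℓ = 0 := by
  ext Y
  have := h Y
  rw [zero_mul] at this
  simpa using norm_le_zero_iff.1 this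

/-- With every read-out of the list equal to `0`, the DEFINED holonomy `holOf ℓs Z` is identically `1`. [folklore] -/
theorem holOf_eq_one_of_readOuts_zero {E : Type*} (ℓs : List (𝒴 →L[ℂ] A)) (h : ∀ ℓ ∈ ℓs, ℓ = 0) (Z : E → 𝒴)
    (y : E) : holOf ℓs Z y = 1 := by
  rw [holOf_apply]
  induction ℓs with
  | nil => simp [wordExp_nil]
  | cons ℓ t ih =>
    have hℓ : ℓ = 0 := h ℓ (by simp)
    have ht : ∀ ℓ' ∈ t, ℓ' = 0 := fun ℓ' hℓ' => h ℓ' (by simp [hℓ'])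
    rw [List.map_cons, wordExp_cons, ih ht, hℓ]
    simp [exp_zero]

omit [NormedAlgebra ℂ A] in
/-- The DEFINED classifier of holonomies that are identically `1` vanishes. [folklore] -/
theorem classifier_eq_zero_of_hol_one {E ι : Type*} {Pu : Finset ι} (hPu : Pu.Nonempty) {hol : ι → E → A} {x : E}
    (h : ∀ p ∈ Pu, hol p x = 1) : classifier hPu hol x = 0 := by
  unfold classifier
  refine le_antisymm (Finset.sup'_le _ _ fun p hp => ?_) ?_
  · rw [h p hp, sub_self, norm_zero]
  · obtain ⟨p, hp⟩ := hPu
    exact le_trans (norm_nonneg _) (Finset.le_sup' (fun p => ‖hol p x - 1‖) hp)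

/-- **S92-SHAPED COROLLARY.**  Under the ONE CALL's rows `hκ`, `hℓ` (classifier read-outs, bound `κr`), `ha` (Stokes
currency, level-blind `κr`), `0 < X`, and fine scales of infimum zero: for EVERY run, comparison, source, slot and
plaquette the read-outs are zero, every holonomy `holOf (ℓs r K t s p) Z ≡ 1`, and the classifier the dictionary row
`hudict` equates with the tested variable is identically `0` — whatever exponent field `Z` is fed in. [folklore] -/
theorem oneCall_classifier_degenerate {σ : Type*} {ιc : Bool → ℕ → σ → Type*} {E : Bool → ℕ → σ → Type*}
    {𝒴 : Bool → ℕ → σ → Type*} [∀ r K s, NormedAddCommGroup (𝒴 r K s)] [∀ r K s, NormedSpace ℂ (𝒴 r K s)]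
    {Pu : ∀ r K (t : ℝ) s, Finset (ιc r K s)} (hPu : ∀ r K t s, (Pu r K t s).Nonempty)
    (ℓs : ∀ r K (t : ℝ) s, ιc r K s → List (𝒴 r K s →L[ℂ] A)) {κr κc X c₁ c₂ zs : ℝ} (hκ : 0 ≤ κr) (hκc : 0 ≤ κc)
    (hℓ : ∀ r K t s, ∀ p ∈ Pu r K t s, ∀ ℓ ∈ ℓs r K t s p, ∀ Y, ‖ℓ Y‖ ≤ κr * ‖Y‖) (hX : 0 < X)
    {η : Bool → ℕ → ℝ} {jl : Bool → ℕ → σ → ℕ}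
    (hs₁ : ∀ r K s, κc * X ≤ c₁ * η r (jl r K s) ^ 2 * zs) (ha : ∀ r K s, κr * X ≤ c₂ * η r (jl r K s) * zs)
    (hinf : ∀ d : ℝ, 0 < d → ∃ r K s, |η r (jl r K s)| < d) :
    (∀ r K t s, ∀ p ∈ Pu r K t s, ∀ ℓ ∈ ℓs r K t s p, ℓ = 0) ∧
      ∀ r K t s (Z : ιc r K s → E r K s → 𝒴 r K s) (x : E r K s),
        classifier (hPu r K t s) (fun p => holOf (ℓs r K t s p) (Z p)) x = 0 := by
  obtain ⟨hr0, -⟩ := levelBlind_readOuts_eq_zero hκ hκc hX hs₁ ha hinf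
  have hzero : ∀ r K t s, ∀ p ∈ Pu r K t s, ∀ ℓ ∈ ℓs r K t s p, ℓ = 0 := fun r K t s p hp ℓ hℓ' =>
    readOut_eq_zero fun Y => by simpa [hr0] using hℓ r K t s p hp ℓ hℓ' Y
  refine ⟨hzero, fun r K t s Z x => classifier_eq_zero_of_hol_one (hPu r K t s) fun p hp => ?_⟩
  exact holOf_eq_one_of_readOuts_zero _ (hzero r K t s p hp) _ _

end Classifier

/-! ## §4 The repair is inhabited: LEVEL-INDEXED read-out constants from three level-free numbers -/

/-- **THE LEVEL-INDEXED LIFT.**  With `κr r j := κ̄r·η r j` and `κc r j := κ̄c·(η r j)²`, S80 f3's three per-slot rows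
`hs₁`, `ha`, `hma` hold AT EVERY LEVEL of BOTH runs from the level-free numbers `κ̄c·X ≤ c₁·zs`, `κ̄r·X ≤ c₂·zs`,
`m·(κ̄r·X) ≤ 1` and `0 < η ≤ 1` — the shape files 1–2 of row S92 should display (`κr κc : Bool → ℕ → ℝ` read at the
slot's lattice level, `hma` per slot). [folklore] -/
theorem levelIndexed_rows {κbr κbc X c₁ c₂ zs : ℝ} {m : ℕ} {η : Bool → ℕ → ℝ} (hη0 : ∀ r j, 0 < η r j)
    (hη1 : ∀ r j, η r j ≤ 1) (hX : 0 ≤ X) (hκbr : 0 ≤ κbr) (h₁ : κbc * X ≤ c₁ * zs) (h₂ : κbr * X ≤ c₂ * zs)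
    (h₃ : (m : ℝ) * (κbr * X) ≤ 1) :
    ∀ r j, (κbc * η r j ^ 2) * X ≤ c₁ * η r j ^ 2 * zs ∧ (κbr * η r j) * X ≤ c₂ * η r j * zs ∧
      (m : ℝ) * ((κbr * η r j) * X) ≤ 1 := by
  intro r j
  have hη := hη0 r j
  refine ⟨?_, ?_, ?_⟩
  · have := mul_le_mul_of_nonneg_left h₁ (sq_nonneg (η r j))
    calc κbc * η r j ^ 2 * X = η r j ^ 2 * (κbc * X) := by ring
      _ ≤ η r j ^ 2 * (c₁ * zs) := this
      _ = c₁ * η r j ^ 2 * zs := by ring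
  · have := mul_le_mul_of_nonneg_left h₂ hη.le
    calc κbr * η r j * X = η r j * (κbr * X) := by ring
      _ ≤ η r j * (c₂ * zs) := this
      _ = c₂ * η r j * zs := by ring
  · have h0 : 0 ≤ (m : ℝ) * (κbr * X) := mul_nonneg (Nat.cast_nonneg _) (mul_nonneg hκbr hX)
    calc (m : ℝ) * (κbr * η r j * X) = η r j * ((m : ℝ) * (κbr * X)) := by ring
      _ ≤ 1 * 1 := mul_le_mul (hη1 r j) h₃ h0 zero_le_one
      _ = 1 := one_mul _

/-- NON-VACUITY of §4 with the designed profile: `η r j = (2^j)⁻¹`, `κ̄r = κ̄c = X = c₁ = c₂ = zs = 1`, `m = 1`.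
[folklore] -/
example : ∀ r j, ((1 : ℝ) * ((fun (_ : Bool) (j : ℕ) => ((2 : ℝ) ^ j)⁻¹) r j) ^ 2) * 1 ≤
    1 * ((fun (_ : Bool) (j : ℕ) => ((2 : ℝ) ^ j)⁻¹) r j) ^ 2 * 1 ∧
    ((1 : ℝ) * ((fun (_ : Bool) (j : ℕ) => ((2 : ℝ) ^ j)⁻¹) r j)) * 1 ≤
      1 * ((fun (_ : Bool) (j : ℕ) => ((2 : ℝ) ^ j)⁻¹) r j) * 1 ∧
    ((1 : ℕ) : ℝ) * (((1 : ℝ) * ((fun (_ : Bool) (j : ℕ) => ((2 : ℝ) ^ j)⁻¹) r j)) * 1) ≤ 1 :=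
  levelIndexed_rows (fun _ j => by positivity) (fun _ j => inv_le_one_of_one_le₀ (one_le_pow₀ (by norm_num)))
    zero_le_one zero_le_one (by norm_num) (by norm_num) (by norm_num)

/-! ## §5 (v1.1) The second level-blind number: the depth-weighted plaquette count `Kw` CAPS the number of
depth-zero Wilson plaquettes of EVERY slot of EVERY level by one real -/

/-- **`hKw` IS A LEVEL-BLIND CAP ON THE BLOCK'S PLAQUETTE COUNT.**  S92's rows `hKw : Σ_{p ∈ Pw} e^{−δw·ϖ_p} ≤ Kw`
and `hϖPw : 0 ≤ ϖ_p` give `#{p ∈ Pw | ϖ_p = 0} ≤ Kw` — for the designed families (`Pw` = the FINE plaquettes of the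
slot's sectioned Wilson action, the block's own plaquettes at depth `0`, `c_geo·η_j^{−4}` of them at lattice level `j`,
F-ne7cp1-g31-1 (ii)) one real `Kw` would have to dominate `c_geo·L^{4j}` at every live level `j` of every comparison.
[folklore] -/
theorem depthZero_card_le {𝔭 : Type*} (Pw : Finset 𝔭) (ϖPw : 𝔭 → ℝ) {δw Kw : ℝ}
    (hKw : ∑ p ∈ Pw, Real.exp (-(δw * ϖPw p)) ≤ Kw) :
    ((Pw.filter fun p => ϖPw p = 0).card : ℝ) ≤ Kw := by
  classical
  have h1 : ((Pw.filter fun p => ϖPw p = 0).card : ℝ) =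
      ∑ p ∈ Pw.filter (fun p => ϖPw p = 0), Real.exp (-(δw * ϖPw p)) := by
    rw [Finset.card_eq_sum_ones, Nat.cast_sum]
    refine Finset.sum_congr rfl fun p hp => ?_
    rw [(Finset.mem_filter.1 hp).2, mul_zero, neg_zero, Real.exp_zero, Nat.cast_one]
  rw [h1]
  exact le_trans (Finset.sum_le_sum_of_subset_of_nonneg (Finset.filter_subset _ _)
    fun p _ _ => (Real.exp_pos _).le) hKw

/-- … in S92's indexing: ONE `Kw` caps the depth-zero plaquette count of every run, comparison, source and slot.
[folklore] -/
theorem oneCall_depthZero_card_le {σ : Type*} {𝔭 : Bool → ℕ → σ → Type*} (Pw : ∀ r K (t : ℝ) s, Finset (𝔭 r K s))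
    (ϖPw : ∀ r K (t : ℝ) s, 𝔭 r K s → ℝ) {δw Kw : ℝ}
    (hKw : ∀ r K t s, ∑ p ∈ Pw r K t s, Real.exp (-(δw * ϖPw r K t s p)) ≤ Kw) :
    ∀ r K t s, (((Pw r K t s).filter fun p => ϖPw r K t s p = 0).card : ℝ) ≤ Kw :=
  fun r K t s => depthZero_card_le (Pw r K t s) (ϖPw r K t s) (hKw r K t s)

/-- NO LEVEL-BLIND CAP EXISTS for an unbounded count family (the designed `c_geo·L^{4j}`): the repair indexes `Kw`
(and the per-plaquette read-out numbers `κwb ∝ η_j`, `κcb ∝ η_j²`, `d̄ ∝ ε_jη_j²` it multiplies in `hDslot`) by the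
slot's level, the product staying level-bounded by the `η_j⁴·η_j^{−4}` cancellation of the square-term budget
(`ShellMeasureWilsonSquare.squareBudget_le`). [folklore] -/
theorem no_levelBlind_cap {ι : Sort*} (N : ι → ℕ) (hN : ∀ B : ℕ, ∃ i, B < N i) : ¬ ∃ Kw : ℝ, ∀ i, (N i : ℝ) ≤ Kw := by
  rintro ⟨Kw, hKw⟩
  obtain ⟨B, hB⟩ := exists_nat_gt Kw
  obtain ⟨i, hi⟩ := hN B
  have : (B : ℝ) < N i := by exact_mod_cast hi
  linarith [hKw i]

/-- The designed count IS unbounded: `j ↦ c·M^j` with `1 ≤ c`, `2 ≤ M` (e.g. `M = L⁴`) exceeds every bound.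
[folklore] -/
theorem designed_count_unbounded {c M : ℕ} (hc : 1 ≤ c) (hM : 2 ≤ M) : ∀ B : ℕ, ∃ j : ℕ, B < c * M ^ j := by
  intro B
  refine ⟨B, ?_⟩
  have h1 : B < 2 ^ B := Nat.lt_two_pow_self
  have h2 : 2 ^ B ≤ M ^ B := Nat.pow_le_pow_left hM B
  calc B < M ^ B := lt_of_lt_of_le h1 h2
    _ = 1 * M ^ B := (one_mul _).symm
    _ ≤ c * M ^ B := Nat.mul_le_mul_right _ hc

end Summit.QuantumFields.BalabanUV.T4Continuum.ShellMeasureLiveEndLevelBlind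

end
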